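import Literature.Probability.Percolation.SlabRSWGluingRoute
import Literature.Probability.Percolation.SlabRSWGluingDirect
import HarnessLib

/-!
# Newman–Tassion–Wu 2017, §3.2 — the gluing lemmas for slabs: contacts, entries, glue paths

Topic: `Literature/Probability/Percolation`. Fourth file of the port of §3 of Newman–Tassion–Wu,
*Critical percolation and the minimal spanning tree in slabs* (CPAM 70 (2017); arXiv:1512.09107).
Geometry-free preparations for the construction of the surgeries of the main gluing lemma
(Thm. 3.7) in general position:

* `Near γ ρ z` — the planar point `z` lies within sup-distance `ρ` of the columns of `γ` (NTW's
  `z ∈ 𝒩(Γ̄, ρ)`), with its one-step stability; `GlueData.evNear` — the event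
  `C̄ ⟷^{R̄} 𝒩(Γ̄, ρ)`; `GlueData.evXn = evAB ∩ evNear ∖ evCA` (NTW's `𝒳`).
* `exists_contact` — CONTACT NORMALISATION: on `evXn` there is an `ω`-open self-avoiding path from
  `C̄` whose last vertex is within `ρ` of `Γ̄` and all of whose other vertices are not (stop the
  path at its first such vertex); consequently its last vertex is not within `ρ - 1`.
* `exists_entry` — the FIRST ENTRY of an open self-avoiding path into the columns over a planar
  set `D`: the piece before it is off `D̄`, and the entry edge is a lattice edge.
* `exists_gluePath` — a lifted L-shaped lattice path inside a box from a vertex to a cell of a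
  target set, stopped at the first target cell (the chains of the direct gluings).
* facts about `Γ`: consecutive vertices are lattice neighbours, a vertex of `Γ` in `B̄` is its last
  vertex (`eq_getLast_of_mem_B`), no vertex of `Γ` lies in `C̄` on `evX`.

## Sources

* C. M. Newman, V. Tassion, W. Wu, *Critical percolation and the minimal spanning tree in slabs*,
  Comm. Pure Appl. Math. 70 (2017), arXiv:1512.09107: §3.2, Theorem 3.7 (the neighbourhood
  `𝒩(Γ̄, r)`, the events `𝒳, 𝒳′`) and its proof, step (1) (`u′, v′, w′` and the path `π`)
  [NewmanTassionWu2017].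
-/

noncomputable section

namespace Literature.Probability.Percolation

open MeasureTheory LatticeModels SimpleGraph Filter Topology

namespace NTW17

variable {k : ℕ}

/-! ## Sup-norm boxes: arithmetic -/

section Boxes

/-- Membership in a sup-norm box, in coordinates. [cite: NewmanTassionWu2017, §2.3 (Notation, B_n(x))] -/
theorem mem_sqBox_iff' {z c : ℤ × ℤ} {n : ℕ} :
    z ∈ sqBox c n ↔ c.1 - n ≤ z.1 ∧ z.1 ≤ c.1 + n ∧ c.2 - n ≤ z.2 ∧ z.2 ≤ c.2 + n := by
  simp only [sqBox, Set.mem_setOf_eq, abs_le]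
  omega

/-- A point lies in its own boxes. [cite: NewmanTassionWu2017, §2.3 (Notation, B_n(x))] -/
theorem mem_sqBox_self (c : ℤ × ℤ) (n : ℕ) : c ∈ sqBox c n := by
  rw [mem_sqBox_iff']; omega

/-- Triangle inequality for sup-norm boxes. [cite: NewmanTassionWu2017, §2.3 (Notation, dist*)] -/
theorem mem_sqBox_add {z w c : ℤ × ℤ} {m n : ℕ} (hz : z ∈ sqBox c m) (hw : w ∈ sqBox z n) :
    w ∈ sqBox c (m + n) := by
  rw [mem_sqBox_iff'] at *; push_cast; omega

/-- Planar-adjacent points are at sup-distance `1`. [cite: NewmanTassionWu2017, §2.3 (Notation, dist*)] -/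
theorem mem_sqBox_one_of_planarAdj {z w : ℤ × ℤ} (h : planarAdj z w) : w ∈ sqBox z 1 := by
  rw [mem_sqBox_iff']
  obtain ⟨z1, z2⟩ := z; obtain ⟨w1, w2⟩ := w
  simp only [planarAdj, Prod.mk_add_mk, Prod.mk.injEq, add_zero] at h
  simp only [Nat.cast_one]
  omega

/-- Adjacent slab vertices project to points at sup-distance at most `1`.
[cite: NewmanTassionWu2017, §2.3 (Notation, dist*)] -/
theorem planar_mem_sqBox_one_of_adj {u v : slab 3 k} (h : (slabGraph 3 k).Adj u v) :
    planar k v ∈ sqBox (planar k u) 1 := by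
  rcases (slab_adj_iff u v).1 h with ⟨-, hp⟩ | ⟨hp, -⟩
  · exact mem_sqBox_one_of_planarAdj hp
  · rw [← hp]; exact mem_sqBox_self _ _

end Boxes

/-! ## Near the columns of a path -/

section Near

variable (k)

/-- **`z ∈ 𝒩(γ̄, ρ)`**: the planar point `z` is within sup-distance `ρ` of the projection of some
vertex of `γ`. [cite: NewmanTassionWu2017, §3.2 (Theorem 3.7, the set 𝒩(Γ̄, r))] -/
def Near (γ : List (slab 3 k)) (ρ : ℕ) (z : ℤ × ℤ) : Prop := ∃ g ∈ γ, z ∈ sqBox (planar k g) ρ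

variable {k}

/-- Monotonicity of `Near` in the radius. [cite: NewmanTassionWu2017, §3.2 (Theorem 3.7, 𝒩(Γ̄, r))] -/
theorem Near.mono {γ : List (slab 3 k)} {ρ ρ' : ℕ} (h : ρ ≤ ρ') {z : ℤ × ℤ} (hz : Near k γ ρ z) :
    Near k γ ρ' z := by
  obtain ⟨g, hg, hz⟩ := hz
  exact ⟨g, hg, sqBox_mono _ h hz⟩

/-- One-step stability: a point at sup-distance `≤ 1` from a point within `ρ` is within `ρ + 1`.
[cite: NewmanTassionWu2017, §3.2 (Theorem 3.7, 𝒩(Γ̄, r))] -/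
theorem Near.step {γ : List (slab 3 k)} {ρ : ℕ} {z w : ℤ × ℤ} (hz : Near k γ ρ z)
    (hw : w ∈ sqBox z 1) : Near k γ (ρ + 1) w := by
  obtain ⟨g, hg, hz⟩ := hz
  exact ⟨g, hg, mem_sqBox_add hz hw⟩

/-- Contrapositive form of the one-step stability: if `w` is not within `ρ + 1`, no point at
sup-distance `≤ 1` from `w` is within `ρ`. [cite: NewmanTassionWu2017, §3.2 (Theorem 3.7, 𝒩(Γ̄, r))] -/
theorem not_near_of_step {γ : List (slab 3 k)} {ρ : ℕ} {z w : ℤ × ℤ} (hw : ¬Near k γ (ρ + 1) w)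
    (hz : z ∈ sqBox w 1) : ¬Near k γ ρ z := fun hz' => hw (hz'.step (GlueGeom.mem_sqBox_comm hz))

/-- A point not within `0` of `γ̄` is not the projection of a vertex of `γ`.
[cite: NewmanTassionWu2017, §3.2 (Theorem 3.7, 𝒩(Γ̄, r))] -/
theorem ne_planar_of_not_near {γ : List (slab 3 k)} {ρ : ℕ} {z : ℤ × ℤ} (hz : ¬Near k γ ρ z)
    {g : slab 3 k} (hg : g ∈ γ) : z ≠ planar k g := by
  rintro rfl; exact hz ⟨g, hg, mem_sqBox_self _ _⟩

end Near

/-! ## The contact event and NTW's `𝒳` -/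

section Events

namespace GlueData

variable (Q : GlueData) (k) (ρ : ℕ)

/-- **`C̄ ⟷^{R̄} 𝒩(Γ̄, ρ)`**: some vertex of `C̄` is joined inside `R̄` to a vertex whose projection is
within `ρ` of the columns of `Γ`. [cite: NewmanTassionWu2017, §3.2 (Theorem 3.7, the event C ↔^R 𝒩(Γ̄, r))] -/
def evNear : Set (BondConfig (slab 3 k)) :=
  {ω | ∃ c₀ ∈ slabLift k Q.C, ∃ q, ω ∈ openConnIn (slabLift k Q.R) c₀ q ∧ Near k (Q.γ k ω) ρ (planar k q)}

/-- **NTW's `𝒳`** (with `Γ` existing): `A ⟷^S B`, `C̄ ⟷^{R̄} 𝒩(Γ̄, ρ)`, and NOT `C ⟷^R A`.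
[cite: NewmanTassionWu2017, §3.2 (proof of Theorem 3.7, the event 𝒳)] -/
def evXn : Set (BondConfig (slab 3 k)) := Q.evX k ∩ Q.evNear k ρ

variable {Q k ρ}

/-- `evXn ⊆ evX`. [cite: NewmanTassionWu2017, §3.2 (proof of Theorem 3.7)] -/
theorem evX_of_evXn {ω : BondConfig (slab 3 k)} (h : ω ∈ Q.evXn k ρ) : ω ∈ Q.evX k := h.1

end GlueData

end Events

/-! ## Facts about `Γ` -/

section GammaFacts

variable {Q : GlueData} {ω : BondConfig (slab 3 k)}

/-- Consecutive vertices of an open path of a lattice configuration are lattice neighbours.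
[cite: NewmanTassionWu2017, §3.2 (proof of Theorem 3.7)] -/
theorem isChain_adj_of_isChain_open (hω : ω ⊆ (slabGraph 3 k).edgeSet) {l : List (slab 3 k)}
    (hl : l.IsChain (fun a b => s(a, b) ∈ ω ∧ a ≠ b)) :
    l.IsChain (fun a b => (slabGraph 3 k).Adj a b) :=
  hl.imp fun _ _ h => (SimpleGraph.mem_edgeSet _).1 (hω h.1)

/-- **A vertex of `Γ` in `B̄` is its last vertex** (a proper prefix of `Γ` ending in `B̄` would be
a smaller open self-avoiding path). [cite: NewmanTassionWu2017, §3.2 (definition of Γ_min, minimality)] -/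
theorem eq_getLast_of_mem_B (hA : ω ∈ Q.evAB k) {v : slab 3 k} (hv : v ∈ Q.γ k ω)
    (hvB : v ∈ slabLift k Q.B) : v = (Q.γ k ω).getLast (Q.γ_spec hA).1.ne_nil := by
  obtain ⟨p, s, hps⟩ := List.append_of_mem hv
  by_cases hs : s = []
  · subst hs
    rw [List.getLast_congr _ (by simp) hps]; simp
  · exfalso
    have hex : ∃ l, IsOSAP k ω (slabLift k Q.S) (slabLift k Q.A) (slabLift k Q.B) l :=
      (mem_slabConn_iff_exists_isOSAP ω _ _ _).1 hA
    have h := minPath_prefix_getLast_not_mem Q.S_finite hex (p := p ++ [v]) (s := s)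
      (by rw [show minPath k ω _ _ _ = Q.γ k ω from rfl, hps]; simp) hs (by simp)
    simp at h
    exact h hvB

/-- Vertices of `Γ` lie in `R̄`. [cite: NewmanTassionWu2017, §3.2 (definition of Γ_min)] -/
theorem GlueData.γ_subset_R (Q : GlueData) {ω : BondConfig (slab 3 k)} (hA : ω ∈ Q.evAB k)
    {v : slab 3 k} (hv : v ∈ Q.γ k ω) : v ∈ slabLift k Q.R :=
  slabLift_mono k Q.hSR ((Q.γ_spec hA).1.subset v hv)

/-- On `evX`, no vertex of `Γ` lies in `C̄`. [cite: NewmanTassionWu2017, §3.2 (proof of Theorem 3.7)] -/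
theorem not_mem_C_of_mem_γ (hX : ω ∈ Q.evX k) {v : slab 3 k} (hv : v ∈ Q.γ k ω) :
    v ∉ slabLift k Q.C := fun hvC =>
  Q.not_joined_γ_of_evX hX hv hvC (openConnIn_refl (Q.γ_subset_R hX.1 hv))

/-- The first vertex of `Γ` lies in `Ā`. [cite: NewmanTassionWu2017, §3.2 (definition of Γ_min)] -/
theorem head_mem_A (hA : ω ∈ Q.evAB k) : (Q.γ k ω).head (Q.γ_spec hA).1.ne_nil ∈ slabLift k Q.A :=
  (Q.γ_spec hA).1.head_mem _

/-- The last vertex of `Γ` lies in `B̄`. [cite: NewmanTassionWu2017, §3.2 (definition of Γ_min)] -/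
theorem getLast_mem_B (hA : ω ∈ Q.evAB k) :
    (Q.γ k ω).getLast (Q.γ_spec hA).1.ne_nil ∈ slabLift k Q.B :=
  (Q.γ_spec hA).1.last_mem _

end GammaFacts

/-! ## Contact normalisation -/

section Contact

variable {Q : GlueData} {ω : BondConfig (slab 3 k)} {ρ : ℕ}

/-- **Contact normalisation** (NTW, proof of Thm. 3.7, step (1): follow the open path from `C`
until it first comes within `r + 1` of `Γ̄`). On `evXn` there are `c₀ ∈ C̄` and an `ω`-open
self-avoiding path `l ++ [q]` inside `R̄` from `c₀` whose last vertex `q` is within `ρ` of `Γ̄`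
while no vertex of `l` is; either `l = []` and `q = c₀`, or `l ≠ []` with head `c₀`.
[cite: NewmanTassionWu2017, §3.2 (proof of Theorem 3.7, step (1), the path π)] -/
theorem exists_contact (h : ω ∈ Q.evXn k ρ) :
    ∃ (c₀ q : slab 3 k) (l : List (slab 3 k)), c₀ ∈ slabLift k Q.C ∧
      (l ++ [q]).IsChain (fun a b => s(a, b) ∈ ω ∧ a ≠ b) ∧ (l ++ [q]).Nodup ∧
      (∀ x ∈ l ++ [q], x ∈ slabLift k Q.R) ∧ (l ++ [q]).head (by simp) = c₀ ∧
      Near k (Q.γ k ω) ρ (planar k q) ∧ ∀ x ∈ l, ¬Near k (Q.γ k ω) ρ (planar k x) := by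
  obtain ⟨-, c₀, hc₀, q₀, hj, hnear⟩ := h
  obtain ⟨L, hL⟩ := exists_isOSAP_of_openConnIn hj
  have hq₀L : q₀ ∈ L := by
    have := hL.last_mem hL.ne_nil
    rw [Set.mem_singleton_iff] at this
    rw [← this]; exact List.getLast_mem _
  obtain ⟨l, q, l₂, hLeq, hq, hl⟩ :=
    exists_first_split (p := fun x => Near k (Q.γ k ω) ρ (planar k x)) L ⟨q₀, hq₀L, hnear⟩
  have hch : (l ++ [q]).IsChain (fun a b => s(a, b) ∈ ω ∧ a ≠ b) := by
    have := hL.chain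
    rw [hLeq, show l ++ q :: l₂ = (l ++ [q]) ++ l₂ by simp] at this
    exact (List.isChain_append.1 this).1
  have hnd : (l ++ [q]).Nodup := by
    have := hL.nodup
    rw [hLeq, show l ++ q :: l₂ = (l ++ [q]) ++ l₂ by simp] at this
    exact (List.nodup_append.1 this).1
  have hsub : ∀ x ∈ l ++ [q], x ∈ slabLift k Q.R := fun x hx =>
    hL.subset x (by rw [hLeq, show l ++ q :: l₂ = (l ++ [q]) ++ l₂ by simp]; exact List.mem_append_left _ hx)
  have hhead : (l ++ [q]).head (by simp) = c₀ := by
    have h1 := hL.head_mem hL.ne_nil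
    rw [Set.mem_singleton_iff] at h1
    have h2 : L.head? = some c₀ := by rw [← h1]; exact List.head?_eq_some_head hL.ne_nil
    have h3 : L = (l ++ [q]) ++ l₂ := by rw [hLeq]; simp
    rw [h3, List.head?_append] at h2
    rw [List.head_eq_iff_head?_eq_some]
    have h4 : (l ++ [q]).head? ≠ none := by simp
    revert h2 h4
    cases (l ++ [q]).head? <;> simp
  exact ⟨c₀, q, l, hc₀, hch, hnd, hsub, hhead, hq, hl⟩

/-- In a normalised contact with a non-trivial path, the contact vertex is NOT within `ρ - 1` of
`Γ̄` (its predecessor is at sup-distance `≤ 1` and not within `ρ`).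
[cite: NewmanTassionWu2017, §3.2 (proof of Theorem 3.7, step (1), dist*(π, Γ̄) = r + 1)] -/
theorem not_near_pred_of_contact (hω : ω ⊆ (slabGraph 3 k).edgeSet) {q : slab 3 k}
    {l : List (slab 3 k)} (hch : (l ++ [q]).IsChain (fun a b => s(a, b) ∈ ω ∧ a ≠ b))
    (hl : ∀ x ∈ l, ¬Near k (Q.γ k ω) ρ (planar k x)) (hlne : l ≠ []) (hρ : 1 ≤ ρ) :
    ¬Near k (Q.γ k ω) (ρ - 1) (planar k q) := by
  have hrel := List.IsChain.rel_getLast_head_of_append hch hlne (by simp)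
  simp only [List.head_cons] at hrel
  have hadj : (slabGraph 3 k).Adj (l.getLast hlne) q := (SimpleGraph.mem_edgeSet _).1 (hω hrel.1)
  have h1 := hl _ (List.getLast_mem hlne)
  rw [show ρ = (ρ - 1) + 1 by omega] at h1
  exact not_near_of_step h1 (planar_mem_sqBox_one_of_adj hadj)

end Contact

/-! ## First entry of an open path into the columns over a planar set -/

section Entry

variable {ω : BondConfig (slab 3 k)}

/-- **First entry.** An `ω`-open self-avoiding path inside `R̄` whose first vertex is off `D̄` and
which has a vertex over `D` splits as `m ++ w' :: rest` with `m ≠ []` off `D̄`, `w'` over `D`,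
and the entry edge `s(m.getLast, w')` open (hence a lattice edge for lattice configurations); the
piece `m` joins the first vertex to `m.getLast` inside `(R ∖ D)‾`.
[cite: NewmanTassionWu2017, §3.2 (proof of Theorem 3.7, step (1), the vertex w′)] -/
theorem exists_entry {R D : Set (ℤ × ℤ)} {L : List (slab 3 k)}
    (hch : L.IsChain (fun a b => s(a, b) ∈ ω ∧ a ≠ b)) (hnd : L.Nodup) (hsub : ∀ x ∈ L, x ∈ slabLift k R)
    (hne : L ≠ []) (hhead : planar k (L.head hne) ∉ D) (hin : ∃ x ∈ L, planar k x ∈ D) :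
    ∃ (m : List (slab 3 k)) (w' : slab 3 k) (rest : List (slab 3 k)) (hm : m ≠ []),
      L = m ++ w' :: rest ∧ (∀ x ∈ m, planar k x ∉ D) ∧ planar k w' ∈ D ∧
      s(m.getLast hm, w') ∈ ω ∧ m.getLast hm ≠ w' ∧ m.head hm = L.head hne ∧
      ω ∈ openConnIn (slabLift k (R \ D)) (L.head hne) (m.getLast hm) ∧
      (m ++ [w']).Nodup := by
  obtain ⟨m, w', rest, hLeq, hw'D, hmD⟩ := exists_first_split (p := fun x => planar k x ∈ D) L hin
  subst hLeq
  have hm : m ≠ [] := by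
    rintro rfl
    exact hhead (by simpa using hw'D)
  have hrel : s(m.getLast hm, w') ∈ ω ∧ m.getLast hm ≠ w' := by
    have := List.IsChain.rel_getLast_head_of_append hch hm (by simp)
    simpa using this
  have hmhead : m.head hm = (m ++ w' :: rest).head hne := (List.head_append_of_ne_nil hm).symm
  have hmch : m.IsChain (fun a b => s(a, b) ∈ ω ∧ a ≠ b) := (List.isChain_append.1 hch).1
  obtain ⟨m₀, m', hm₀⟩ := List.exists_cons_of_ne_nil hm
  have hconn : ω ∈ openConnIn (slabLift k (R \ D)) (m.head hm) (m.getLast hm) := by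
    subst hm₀
    have hsubm : ∀ x ∈ m₀ :: m', x ∈ slabLift k (R \ D) := fun x hx =>
      ⟨hsub x (List.mem_append_left _ hx), hmD x hx⟩
    exact openConnIn_of_isChain m₀ m' hmch hsubm
  have hnd' : (m ++ [w']).Nodup := by
    rw [show m ++ w' :: rest = (m ++ [w']) ++ rest by simp] at hnd
    exact (List.nodup_append.1 hnd).1
  exact ⟨m, w', rest, hm, rfl, hmD, hw'D, hrel.1, hrel.2, hmhead, hmhead ▸ hconn, hnd'⟩

end Entry

/-! ## Glue paths: a lifted L-shaped path stopped at the first target cell -/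

section GluePath

/-- A prefix of a planar path ending at a chosen vertex is a planar path.
[cite: NewmanTassionWu2017, §3.2 (proof of Theorem 3.7, step (3))] -/
theorem ppath_prefix {l m₁ m₂ : List (ℤ × ℤ)} {s t x : ℤ × ℤ} (h : PPath l s t) (hl : l = m₁ ++ x :: m₂)
    (hm₁ : m₁ ≠ []) : PPath (m₁ ++ [x]) s x where
  ne_nil := by simp
  chain := by
    have := h.chain
    rw [hl, show m₁ ++ x :: m₂ = (m₁ ++ [x]) ++ m₂ by simp] at this
    exact (List.isChain_append.1 this).1
  nodup := by
    have := h.nodup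
    rw [hl, show m₁ ++ x :: m₂ = (m₁ ++ [x]) ++ m₂ by simp] at this
    exact (List.nodup_append.1 this).1
  head := by
    have := h.head
    rw [hl, List.head?_append_of_ne_nil _ hm₁] at this
    rw [List.head?_append_of_ne_nil _ hm₁]; exact this
  last := by simp

/-- **Glue path.** In a box containing the planar point `p` of a vertex `w'` (not a target cell)
and a target cell `t ∈ Tg`, there is a self-avoiding lattice chain `L` at the height of `w'`,
starting at `w'`, inside the box, ending over `Tg`, with no earlier vertex over `Tg`.
[cite: NewmanTassionWu2017, §3.2 (proof of Theorem 3.7, step (3), the path γ_w)] -/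
theorem exists_gluePath {xL xR rB rT : ℤ} {Tg : Set (ℤ × ℤ)} (w' : slab 3 k)
    (hw' : planar k w' ∈ boxR xL xR rB rT) (hw'T : planar k w' ∉ Tg) {t : ℤ × ℤ}
    (htb : t ∈ boxR xL xR rB rT) (htT : t ∈ Tg) :
    ∃ L : List (slab 3 k), ∃ hL : L ≠ [], L.head hL = w' ∧ (∀ x ∈ L, planar k x ∈ boxR xL xR rB rT) ∧
      L.IsChain (fun a b => (slabGraph 3 k).Adj a b) ∧ L.Nodup ∧
      L.getLast hL ∈ slabLift k Tg ∧ ∀ x ∈ L.dropLast, x ∉ slabLift k Tg := by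
  classical
  set p := planar k w' with hp
  obtain ⟨P, hP, hPmem⟩ := exists_lpath_vh p t
  have hPbox : ∀ z ∈ P, z ∈ boxR xL xR rB rT := by
    intro z hz
    rw [mem_boxR_iff] at hw' htb ⊢
    rcases (hPmem z).1 hz with ⟨h1, h2, h3⟩ | ⟨h1, h2, h3⟩
    · rw [min_def, max_def] at *; split_ifs at * <;> omega
    · rw [min_def, max_def] at *; split_ifs at * <;> omega
  have htP : t ∈ P := hP.last_mem
  obtain ⟨m₁, x, m₂, hPeq, hxT, hm₁T⟩ := exists_first_split (p := fun z => z ∈ Tg) P ⟨t, htP, htT⟩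
  have hm₁ : m₁ ≠ [] := by
    rintro rfl
    have := hP.head
    rw [hPeq] at this
    simp at this
    exact hw'T (this ▸ hxT)
  have hQ : PPath (m₁ ++ [x]) p x := ppath_prefix hP hPeq hm₁
  set h := ht w' with hh
  have hhk : h ≤ k := ht_le w'
  refine ⟨liftH k h (m₁ ++ [x]), liftH_ne_nil (by simp), ?_, ?_, liftH_isChain h hQ.chain,
    liftH_nodup hQ.nodup, ?_, ?_⟩
  · -- head
    rw [List.head_eq_iff_head?_eq_some, head?_liftH, hQ.head]
    simp only [Option.map_some, Option.some.injEq]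
    rw [hp, hh, vtx_planar_ht]
  · intro y hy
    rw [mem_liftH_iff hhk] at hy
    refine hPbox _ ?_
    rw [hPeq, show m₁ ++ x :: m₂ = (m₁ ++ [x]) ++ m₂ by simp]
    exact List.mem_append_left _ hy.1
  · -- last vertex over `Tg`
    have : (liftH k h (m₁ ++ [x])).getLast (liftH_ne_nil (by simp)) = vtx k x h := by
      rw [List.getLast_eq_iff_getLast?_eq_some, getLast?_liftH]; simp
    rw [this, mem_slabLift_iff, planar_vtx]
    exact hxT
  · intro y hy
    rw [liftH, List.map_append, List.map_singleton, List.dropLast_concat, ← liftH,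
      mem_liftH_iff hhk] at hy
    rw [mem_slabLift_iff]
    exact hm₁T _ hy.1

end GluePath

/-! ## Assembling a direct gluing from an entry and a glue path -/

section DirectAssemble

variable {ω : BondConfig (slab 3 k)}

/-- **Direct gluing from an entry.** Given a box `Db ⊆ R` off `Src`, a source vertex `s₀ ∈ S̄rc`
joined inside `(R ∖ Db)‾` to `q₁ ∉ D̄b`, a lattice neighbour `w'` of `q₁` over `Db` not over
`Tg`, and a target cell in `Db`, there is a direct gluing with cleared set `Db`.
[cite: NewmanTassionWu2017, §3.2 (proof of Theorem 3.7, steps (2)–(3))] -/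
theorem exists_directGlue {R Src Tg : Set (ℤ × ℤ)} {xL xR rB rT : ℤ}
    (hDR : boxR xL xR rB rT ⊆ R) (hDSrc : ∀ z ∈ boxR xL xR rB rT, z ∉ Src)
    {s₀ q₁ w' : slab 3 k} (hs₀ : s₀ ∈ slabLift k Src) (hq₁D : planar k q₁ ∉ boxR xL xR rB rT)
    (hσ : ω ∈ openConnIn (slabLift k (R \ boxR xL xR rB rT)) s₀ q₁)
    (hadj : (slabGraph 3 k).Adj q₁ w') (hw' : planar k w' ∈ boxR xL xR rB rT)
    (hw'T : planar k w' ∉ Tg) {t : ℤ × ℤ} (ht : t ∈ boxR xL xR rB rT) (htT : t ∈ Tg) :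
    ∃ dg : DirectGlue k R Src Tg ω, dg.D = boxR xL xR rB rT := by
  obtain ⟨L, hL, hLhead, hLD, hLch, hLnd, hLlast, hLoff⟩ := exists_gluePath w' hw' hw'T ht htT
  obtain ⟨w₀, L', hLeq⟩ := List.exists_cons_of_ne_nil hL
  have hw₀ : w₀ = w' := by rw [← hLhead]; simp [hLeq]
  subst hw₀
  have hq₁L : q₁ ∉ L := fun h => hq₁D (hLD _ h)
  refine ⟨⟨boxR xL xR rB rT, q₁, s₀, L, hDR, hDSrc, hq₁D, hs₀, hσ, hL, hLD, ?_, List.nodup_cons.2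
    ⟨hq₁L, hLnd⟩, hLlast, hLoff⟩, rfl⟩
  rw [hLeq, List.isChain_cons_cons]
  exact ⟨hadj, hLeq ▸ hLch⟩

end DirectAssemble

end NTW17

end Literature.Probability.Percolation
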